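import Literature.MathematicalPhysics.KineticTheory.HardSphereCollisionCampbell
import Literature.Analysis.FluidPDE.HardSphereScattering
import Literature.Analysis.FluidPDE.HardSphereUniqueness
import HarnessLib

/-!
# Relabelling covariance of the hit-piece integrals of the Campbell engine

Topic `Literature/MathematicalPhysics/KineticTheory`. Relabelling the particles of a phase point
of `N` hard spheres on `T^d` by a permutation `σ` of `Fin N`, `u ↦ u ∘ σ`, preserves Lebesgue
measure on `(T^d × ℝ^d)^N` (`campbell_lintegral_comp_perm`, from
`MeasureTheory.volume_measurePreserving_piCongrLeft`), and every object of the one-window analysis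
of the hard-sphere flow is covariant under it: free flight (`freeFlight_comp_perm`), the elastic
collision of a pair (`collidePair_comp_perm`), the contact insertion (`contactInsert_comp_perm`),
the hit piece of a pair (`comp_perm_mem_hitPiece_iff`: `u ∘ σ` lies in the hit piece of `(i, j)`
iff `u` lies in the hit piece of `(σ i, σ j)`) and the kinetic energy (`configEnergy_comp_perm`).
Consequently both sides of the change of variables to pre-collision cylinder coordinates on an
energy-cut hit piece — the engine of the discharge of `HardSphereCampbellFormula`
(Cercignani–Illner–Pulvirenti 1994 App. 4.A: in the special flow representation the Lebesgue
measure becomes `dσ dt`) — are transported from the ordered pair `(a, b)` to the pair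
`(σ a, σ b)`:

* `lintegral_hitPiece_comp_perm` — the phase-space side
  `∫ 1_{hit(a,b) ∩ {E ≤ V²/2}}(u) H(collide_{ab} S_{τ₀(u)} u) du`;
* `lintegral_hitPieceCylinder_comp_perm` — the cylinder-coordinate side
  `∫ dz ∫ dω ∫_{τ>0} ε^{d-1} ⟪ω, v_a − v_b⟫ 1_{hit(a,b) ∩ {E ≤ V²/2}}(S_{−τ} collide_{ab} z^{ab}_ω) H(z^{ab}_ω)`;
* `lintegral_hitPieceCylinderIoc_comp_perm` — the same with the `τ`-integral over the window
  `(0, δ]` (the form in which the engine identity holds on the torus).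

In all of them the substitution `u := u' ∘ σ` in the left-hand side produces the right-hand side, the
relabelled mark being `H (· ∘ σ)`. This reduces the engine for an arbitrary ordered pair to the
engine for one fixed pair (the dynamics of identical spheres is label-blind,
Gallagher–Saint-Raymond–Texier 2013 §1.1 (1.1.3)).

## References

* C. Cercignani, R. Illner, M. Pulvirenti, *The Mathematical Theory of Dilute Gases*, Applied
  Math. Sciences 106, Springer (1994), §4.2, App. 4.A pp. 107–111.
* I. Gallagher, L. Saint-Raymond, B. Texier, *From Newton to Boltzmann: hard spheres and
  short-range potentials*, EMS (2013), arXiv:1208.5753, §1.1 (1.1.3), §4.2.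
-/

open MeasureTheory Set Function Filter Metric
open scoped ENNReal NNReal RealInnerProductSpace

namespace Literature.MathematicalPhysics.KineticTheory

open Literature.Analysis.FluidPDE

noncomputable section

variable {d : Type*} [Fintype d] {N : ℕ}

/-! ### Covariance of the static objects under relabelling -/

omit [Fintype d] in
/-- Unordered pairs of labels under a permutation: `{σ k, σ l} = {σ i, σ j} ↔ {k, l} = {i, j}`.
[folklore] -/
theorem campbell_finsetPair_perm_eq_iff (σ : Equiv.Perm (Fin N)) (k l i j : Fin N) :
    (({σ k, σ l} : Finset (Fin N)) = {σ i, σ j}) ↔ (({k, l} : Finset (Fin N)) = {i, j}) := by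
  simp only [Alexander.finsetPair_eq_iff, EmbeddingLike.apply_eq_iff_eq]

/-- `OthersFar` under relabelling: all pairs of `u ∘ σ` other than `{i, j}` are far iff all
pairs of `u` other than `{σ i, σ j}` are far. [folklore] -/
theorem othersFar_comp_perm_iff (σ : Equiv.Perm (Fin N)) (ε r : ℝ)
    (u : Config N d (UnitAddTorus d)) (i j : Fin N) :
    Alexander.OthersFar ε r (u ∘ σ : Config N d (UnitAddTorus d)) i j ↔
      Alexander.OthersFar ε r u (σ i) (σ j) := by
  unfold Alexander.OthersFar
  constructor
  · intro h k l hkl hne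
    have hne' : ({σ.symm k, σ.symm l} : Finset (Fin N)) ≠ {i, j} := fun heq => hne (by
      simpa only [Equiv.apply_symm_apply] using
        (campbell_finsetPair_perm_eq_iff σ (σ.symm k) (σ.symm l) i j).2 heq)
    simpa only [Function.comp_apply, Equiv.apply_symm_apply] using
      h (σ.symm k) (σ.symm l) (σ.symm.injective.ne hkl) hne'
  · intro h k l hkl hne
    exact h (σ k) (σ l) (σ.injective.ne hkl)
      (fun heq => hne ((campbell_finsetPair_perm_eq_iff σ k l i j).1 heq))

/-- The kinetic energy is invariant under relabelling. [folklore] -/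
theorem configEnergy_comp_perm {X : Type*} (σ : Equiv.Perm (Fin N)) (u : Config N d X) :
    configEnergy (u ∘ σ : Config N d X) = configEnergy u := by
  simp only [configEnergy, Function.comp_apply]
  congr 1
  exact Equiv.sum_comp σ (fun i => ‖(u i).2‖ ^ 2)

/-- **The hit piece under relabelling**: `u ∘ σ` lies in the hit piece of the pair `(i, j)` iff
`u` lies in the hit piece of `(σ i, σ j)` (the relative data of `(i, j)` in `u ∘ σ` are those of
`(σ i, σ j)` in `u`, and the other pairs correspond under `σ`). [folklore] -/
theorem comp_perm_mem_hitPiece_iff (σ : Equiv.Perm (Fin N)) (ε r δ : ℝ)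
    (u : Config N d (UnitAddTorus d)) (i j : Fin N) :
    (u ∘ σ : Config N d (UnitAddTorus d)) ∈ Alexander.hitPiece N ε r δ i j ↔
      u ∈ Alexander.hitPiece N ε r δ (σ i) (σ j) := by
  simp only [Alexander.hitPiece, mem_setOf_eq, othersFar_comp_perm_iff, Function.comp_apply]

/-- The energy-cut hit piece under relabelling. [folklore] -/
theorem comp_perm_mem_hitPiece_inter_iff (σ : Equiv.Perm (Fin N)) (ε r δ c : ℝ) (i j : Fin N)
    (w : Config N d (UnitAddTorus d)) :
    (w ∘ σ : Config N d (UnitAddTorus d)) ∈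
        Alexander.hitPiece N ε r δ i j ∩ {u | configEnergy u ≤ c} ↔
      w ∈ Alexander.hitPiece N ε r δ (σ i) (σ j) ∩ {u | configEnergy u ≤ c} := by
  simp only [mem_inter_iff, mem_setOf_eq, comp_perm_mem_hitPiece_iff, configEnergy_comp_perm]

/-- Indicators of the energy-cut hit pieces under relabelling: if `f (w ∘ σ) = g w` then
`1_{hit(i,j) ∩ shell} f` at `w ∘ σ` is `1_{hit(σ i, σ j) ∩ shell} g` at `w`. [folklore] -/
theorem indicator_hitPiece_inter_comp_perm (σ : Equiv.Perm (Fin N)) (ε r δ c : ℝ) (i j : Fin N)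
    (f g : Config N d (UnitAddTorus d) → ℝ≥0∞) (w : Config N d (UnitAddTorus d))
    (hfg : f (w ∘ σ) = g w) :
    (Alexander.hitPiece N ε r δ i j ∩ {u | configEnergy u ≤ c}).indicator f (w ∘ σ) =
      (Alexander.hitPiece N ε r δ (σ i) (σ j) ∩ {u | configEnergy u ≤ c}).indicator g w := by
  by_cases hw : w ∈ Alexander.hitPiece N ε r δ (σ i) (σ j) ∩ {u | configEnergy u ≤ c}
  · rw [indicator_of_mem hw,
      indicator_of_mem ((comp_perm_mem_hitPiece_inter_iff σ ε r δ c i j w).2 hw), hfg]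
  · rw [indicator_of_notMem hw,
      indicator_of_notMem (fun h => hw ((comp_perm_mem_hitPiece_inter_iff σ ε r δ c i j w).1 h))]

omit [Fintype d] in
/-- **The contact insertion under relabelling**: inserting `i` at contact with `j` in `z ∘ σ` is
inserting `σ i` at contact with `σ j` in `z` and relabelling. [folklore] -/
theorem contactInsert_comp_perm (σ : Equiv.Perm (Fin N)) (ε : ℝ) (i j : Fin N)
    (ω : EuclideanSpace ℝ d) (z : Config N d (UnitAddTorus d)) :
    contactInsert ε i j ω (z ∘ σ : Config N d (UnitAddTorus d)) =
      (contactInsert ε (σ i) (σ j) ω z ∘ σ : Config N d (UnitAddTorus d)) := by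
  unfold contactInsert
  rw [Function.update_comp_equiv z σ (σ i), Equiv.symm_apply_apply]
  rfl

/-! ### Relabelling preserves Lebesgue measure -/

/-- **Relabelling preserves Lebesgue measure on phase space**: `∫ F(u ∘ σ) du = ∫ F(u) du` for
every `F ≥ 0` (`u ↦ u ∘ σ` is the volume-preserving measurable equivalence
`MeasurableEquiv.piCongrLeft _ σ⁻¹`; no measurability of `F` is needed). [folklore] -/
theorem campbell_lintegral_comp_perm (σ : Equiv.Perm (Fin N))
    (F : Config N d (UnitAddTorus d) → ℝ≥0∞) :
    ∫⁻ u : Config N d (UnitAddTorus d), F (u ∘ σ) = ∫⁻ u, F u := by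
  -- adapted from `Literature.MathematicalPhysics.QuantumManyBody.BoseGasProductState.lintegral_comp_perm`
  haveI : SigmaFinite (volume : Measure (UnitAddTorus d × EuclideanSpace ℝ d)) := inferInstance
  have hmp := volume_measurePreserving_piCongrLeft
    (fun _ : Fin N => UnitAddTorus d × EuclideanSpace ℝ d) σ.symm
  have h : ∀ u : Config N d (UnitAddTorus d),
      (MeasurableEquiv.piCongrLeft (fun _ : Fin N => UnitAddTorus d × EuclideanSpace ℝ d) σ.symm) u =
        (u ∘ σ : Config N d (UnitAddTorus d)) := by
    intro u
    funext k
    simp [MeasurableEquiv.piCongrLeft, Equiv.piCongrLeft_apply_eq_cast]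
  have key := hmp.lintegral_comp_emb (MeasurableEquiv.measurableEmbedding _) F
  simpa only [h] using key

/-! ### The two sides of the engine under relabelling -/

/-- **Relabelling covariance of the hit-piece integral** (phase-space side of the Campbell engine):
for a permutation `σ`, a pair `a ≠ b` and a measurable mark `H ≥ 0`,
`∫ 1_{hit(a,b) ∩ {E ≤ V²/2}}(u) H(collide_{ab}(S_{τ₀(u)} u)) du
 = ∫ 1_{hit(σa,σb) ∩ {E ≤ V²/2}}(u) H(collide_{σa,σb}(S_{τ₀(u)} u) ∘ σ) du`
(substitute `u := u ∘ σ`, which preserves Lebesgue measure; the hit piece, the energy, the hitting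
time, free flight and the pair collision are covariant). [folklore] -/
theorem lintegral_hitPiece_comp_perm (σ : Equiv.Perm (Fin N)) {r δ V : ℝ} (ε : ℝ)
    {a b : Fin N} (hab : a ≠ b)
    {H : Config N d (UnitAddTorus d) → ℝ≥0∞} (hH : Measurable H) :
    ∫⁻ u : Config N d (UnitAddTorus d),
        (Alexander.hitPiece N ε r δ a b ∩ {u | configEnergy u ≤ V ^ 2 / 2}).indicator
          (fun u => H (collidePair (Torus.geometry d) a b
            (freeFlight (Torus.geometry d)
              (pairHitTime ε ((Torus.geometry d).sepVec (u a).1 (u b).1) ((u a).2 - (u b).2)) u))) u =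
      ∫⁻ u : Config N d (UnitAddTorus d),
        (Alexander.hitPiece N ε r δ (σ a) (σ b) ∩ {u | configEnergy u ≤ V ^ 2 / 2}).indicator
          (fun u => H ((collidePair (Torus.geometry d) (σ a) (σ b)
            (freeFlight (Torus.geometry d)
              (pairHitTime ε ((Torus.geometry d).sepVec (u (σ a)).1 (u (σ b)).1) ((u (σ a)).2 - (u (σ b)).2))
                u)) ∘ σ)) u := by
  have _ := hH
  refine (campbell_lintegral_comp_perm σ _).symm.trans ?_
  refine lintegral_congr fun u => ?_
  refine indicator_hitPiece_inter_comp_perm σ ε r δ _ a b _ _ u ?_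
  simp only [Function.comp_apply]
  rw [freeFlight_comp_perm, collidePair_comp_perm hab]

/-- **Relabelling covariance of the cylinder-coordinate integral** (collision-coordinate side of
the Campbell engine): for a permutation `σ`, a pair `a ≠ b` and a measurable mark `H ≥ 0`,
`∫ dz ∫ dω ∫_{τ>0} ε^{d-1} ⟪ω, v_a − v_b⟫ 1_{hit(a,b) ∩ shell}(S_{−τ} collide_{ab} z^{ab}_ω) H(z^{ab}_ω)`
equals the same expression for the pair `(σ a, σ b)` with the mark `H (· ∘ σ)` (substitute
`z := z ∘ σ` in the outer integral only; the contact insertion, the pair collision, free flight,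
the hit piece and the energy are covariant, and the velocities of `(a, b)` in `z ∘ σ` are those of
`(σ a, σ b)` in `z`). [folklore] -/
theorem lintegral_hitPieceCylinder_comp_perm (σ : Equiv.Perm (Fin N)) {r δ V : ℝ} (ε : ℝ)
    {a b : Fin N} (hab : a ≠ b)
    {H : Config N d (UnitAddTorus d) → ℝ≥0∞} (hH : Measurable H) :
    ∫⁻ z : Config N d (UnitAddTorus d), ∫⁻ ω : Metric.sphere (0 : EuclideanSpace ℝ d) 1,
        ∫⁻ τ in Ioi (0 : ℝ),
          ENNReal.ofReal (ε ^ (Fintype.card d - 1) * ⟪((ω : EuclideanSpace ℝ d)), (z a).2 - (z b).2⟫) *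
            (Alexander.hitPiece N ε r δ a b ∩ {u | configEnergy u ≤ V ^ 2 / 2}).indicator (fun _ => (1 : ℝ≥0∞))
              (freeFlight (Torus.geometry d) (-τ)
                (collidePair (Torus.geometry d) a b (contactInsert ε a b (ω : EuclideanSpace ℝ d) z))) *
            H (contactInsert ε a b (ω : EuclideanSpace ℝ d) z)
        ∂volume ∂(volume : Measure (EuclideanSpace ℝ d)).toSphere =
      ∫⁻ z : Config N d (UnitAddTorus d), ∫⁻ ω : Metric.sphere (0 : EuclideanSpace ℝ d) 1,
        ∫⁻ τ in Ioi (0 : ℝ),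
          ENNReal.ofReal (ε ^ (Fintype.card d - 1) * ⟪((ω : EuclideanSpace ℝ d)), (z (σ a)).2 - (z (σ b)).2⟫) *
            (Alexander.hitPiece N ε r δ (σ a) (σ b) ∩ {u | configEnergy u ≤ V ^ 2 / 2}).indicator
                (fun _ => (1 : ℝ≥0∞))
              (freeFlight (Torus.geometry d) (-τ)
                (collidePair (Torus.geometry d) (σ a) (σ b)
                  (contactInsert ε (σ a) (σ b) (ω : EuclideanSpace ℝ d) z))) *
            H ((contactInsert ε (σ a) (σ b) (ω : EuclideanSpace ℝ d) z) ∘ σ)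
        ∂volume ∂(volume : Measure (EuclideanSpace ℝ d)).toSphere := by
  have _ := hH
  refine (campbell_lintegral_comp_perm σ _).symm.trans ?_
  refine lintegral_congr fun z => ?_
  refine lintegral_congr fun ω => ?_
  refine lintegral_congr fun τ => ?_
  simp only [Function.comp_apply]
  rw [contactInsert_comp_perm, collidePair_comp_perm hab, freeFlight_comp_perm,
    indicator_hitPiece_inter_comp_perm σ ε r δ _ a b _ (fun _ => (1 : ℝ≥0∞)) _ rfl]

/-- **Relabelling covariance of the cylinder-coordinate integral over the window `(0, δ]`**
(collision-coordinate side of the Campbell engine on the torus, where the engine identity holds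
only over the time window): for a permutation `σ`, a pair `a ≠ b` and a measurable mark `H ≥ 0`,
`∫ dz ∫ dω ∫_{0<τ≤δ} ε^{d-1} ⟪ω, v_a − v_b⟫ 1_{hit(a,b) ∩ shell}(S_{−τ} collide_{ab} z^{ab}_ω) H(z^{ab}_ω)`
equals the same expression for the pair `(σ a, σ b)` with the mark `H (· ∘ σ)` (the `τ`-set plays
no role: substitute `z := z ∘ σ` in the outer integral only, exactly as in
`lintegral_hitPieceCylinder_comp_perm`). [folklore] -/
theorem lintegral_hitPieceCylinderIoc_comp_perm (σ : Equiv.Perm (Fin N)) {r δ V : ℝ} (ε : ℝ)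
    {a b : Fin N} (hab : a ≠ b)
    {H : Config N d (UnitAddTorus d) → ℝ≥0∞} (hH : Measurable H) :
    ∫⁻ z : Config N d (UnitAddTorus d), ∫⁻ ω : Metric.sphere (0 : EuclideanSpace ℝ d) 1,
        ∫⁻ τ in Ioc (0 : ℝ) δ,
          ENNReal.ofReal (ε ^ (Fintype.card d - 1) * ⟪((ω : EuclideanSpace ℝ d)), (z a).2 - (z b).2⟫) *
            (Alexander.hitPiece N ε r δ a b ∩ {u | configEnergy u ≤ V ^ 2 / 2}).indicator (fun _ => (1 : ℝ≥0∞))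
              (freeFlight (Torus.geometry d) (-τ)
                (collidePair (Torus.geometry d) a b (contactInsert ε a b (ω : EuclideanSpace ℝ d) z))) *
            H (contactInsert ε a b (ω : EuclideanSpace ℝ d) z)
        ∂volume ∂(volume : Measure (EuclideanSpace ℝ d)).toSphere =
      ∫⁻ z : Config N d (UnitAddTorus d), ∫⁻ ω : Metric.sphere (0 : EuclideanSpace ℝ d) 1,
        ∫⁻ τ in Ioc (0 : ℝ) δ,
          ENNReal.ofReal (ε ^ (Fintype.card d - 1) * ⟪((ω : EuclideanSpace ℝ d)), (z (σ a)).2 - (z (σ b)).2⟫) *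
            (Alexander.hitPiece N ε r δ (σ a) (σ b) ∩ {u | configEnergy u ≤ V ^ 2 / 2}).indicator
                (fun _ => (1 : ℝ≥0∞))
              (freeFlight (Torus.geometry d) (-τ)
                (collidePair (Torus.geometry d) (σ a) (σ b)
                  (contactInsert ε (σ a) (σ b) (ω : EuclideanSpace ℝ d) z))) *
            H ((contactInsert ε (σ a) (σ b) (ω : EuclideanSpace ℝ d) z) ∘ σ)
        ∂volume ∂(volume : Measure (EuclideanSpace ℝ d)).toSphere := by
  have _ := hH
  refine (campbell_lintegral_comp_perm σ _).symm.trans ?_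
  refine lintegral_congr fun z => ?_
  refine lintegral_congr fun ω => ?_
  refine lintegral_congr fun τ => ?_
  simp only [Function.comp_apply]
  rw [contactInsert_comp_perm, collidePair_comp_perm hab, freeFlight_comp_perm,
    indicator_hitPiece_inter_comp_perm σ ε r δ _ a b _ (fun _ => (1 : ℝ≥0∞)) _ rfl]

end

end Literature.MathematicalPhysics.KineticTheory
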